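import Summits.HodgeConjecture.HodgeCM.Model.Toy.Duality_3

/-! PORT of `HodgeCM/Model/Toy/Duality.lean` (HodgeCMPerL run 82) — part 4: continuation of `Summits.HodgeConjecture.HodgeCM.Model.Toy.Duality_3` (split at a top-level declaration boundary by port_pkg.py; scope re-opened below; declarations unchanged). -/

-- port_pkg: scope re-opened for this part (file-level context, then the namespace/section stack open at the cut)
noncomputable section
namespace HodgeCM.Toy
open Literature.AlgebraicGeometry.Motives
open Literature.AlgebraicGeometry.Motives.HodgeStructure (EndAction conj ofRat ofRat_apply complexConj
  mem_hodgeClasses_iff)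
open Literature.AlgebraicGeometry.ShimuraVarieties (conjRingHomK embedding_conjRingHomK)
open scoped TensorProduct
open exteriorPower CMPresentation Module
variable (K : CMField) (Φ : Fin 4 → CMType K)
section Inj
variable (K : CMField) (Φ : Fin 4 → CMType K) (k : ℕ)
  (hk : Module.finrank ℚ (PP K Φ).L = k+1+1+1+1)
include hk
/-- (Ported verbatim from the HodgeCMPerL package; no docstring in the source.) -/
lemma image_eq_univ (w : Fin (k + (1+1+1+1)) → (PP K Φ).Idx) (hw : Function.Injective w) :
    Finset.univ.image w = Finset.univ :=
  Finset.eq_univ_of_card _ (by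
    rw [Finset.card_image_of_injective _ hw, Finset.card_univ, Fintype.card_fin, card_Idx_eq K Φ k hk])

/-- (Ported verbatim from the HodgeCMPerL package; no docstring in the source.) -/
lemma image_eq_sdiff {g : Fin k → (PP K Φ).Idx} {v : Fin (1+1+1+1) → (PP K Φ).Idx}
    (h : Function.Injective (Fin.append g v)) :
    Finset.univ.image v = Finset.univ \ Finset.univ.image g := by
  obtain ⟨-, -, hne⟩ := Fin.append_injective_iff.mp h
  have hu := image_eq_univ K Φ k hk _ h
  rw [image_append] at hu
  ext x
  simp only [Finset.mem_sdiff, Finset.mem_univ, true_and, Finset.mem_image]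
  constructor
  · rintro ⟨j, rfl⟩ ⟨i, hi⟩
    exact hne i j hi
  · intro hx
    have hx' : x ∈ Finset.univ.image g ∪ Finset.univ.image v := by
      rw [hu]; exact Finset.mem_univ x
    rw [Finset.mem_union, Finset.mem_image, Finset.mem_image] at hx'
    rcases hx' with ⟨i, -, hi⟩ | ⟨j, -, hj⟩
    · exact absurd ⟨i, hi⟩ hx
    · exact ⟨j, hj⟩

/-- (Ported verbatim from the HodgeCMPerL package; no docstring in the source.) -/
lemma τ_eq_zero_of_ne {g g' : Fin k → (PP K Φ).Idx}
    (hne : Finset.univ.image g ≠ Finset.univ.image g') (v : Fin (1+1+1+1) → (PP K Φ).Idx) :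
    τ K Φ k hk g g' v = 0 := by
  by_cases h1 : Function.Injective (Fin.append g v)
  · by_cases h2 : Function.Injective (Fin.append g' v)
    · exfalso
      apply hne
      have e1 := image_eq_sdiff K Φ k hk h1
      have e2 := image_eq_sdiff K Φ k hk h2
      calc Finset.univ.image g
          = Finset.univ \ (Finset.univ \ Finset.univ.image g) :=
            (Finset.sdiff_sdiff_eq_self (Finset.subset_univ _)).symm
        _ = Finset.univ \ (Finset.univ \ Finset.univ.image g') := by rw [← e1, e2]
        _ = Finset.univ.image g' := Finset.sdiff_sdiff_eq_self (Finset.subset_univ _)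
    · exact τ_eq_zero_right K Φ k hk h2
  · exact τ_eq_zero_left K Φ k hk h1

/-- (Ported verbatim from the HodgeCMPerL package; no docstring in the source.) -/
lemma τ_eq_of_injective {g : Fin k → (PP K Φ).Idx} {v₀ v : Fin (1+1+1+1) → (PP K Φ).Idx}
    (h₀ : Function.Injective (Fin.append g v₀)) (h : Function.Injective (Fin.append g v)) :
    τ K Φ k hk g g v = τ K Φ k hk g g v₀ := by
  obtain ⟨-, hv, -⟩ := Fin.append_injective_iff.mp h
  obtain ⟨-, hv₀, -⟩ := Fin.append_injective_iff.mp h₀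
  have hr : Set.range v = Set.range v₀ := by
    have e := (image_eq_sdiff K Φ k hk h).trans (image_eq_sdiff K Φ k hk h₀).symm
    have e' := congrArg (fun s : Finset (PP K Φ).Idx => (s : Set (PP K Φ).Idx)) e
    simpa only [Finset.coe_image, Finset.coe_univ, Set.image_univ] using e'
  obtain ⟨σ, rfl⟩ := exists_perm_of_range_eq hv hv₀ hr
  exact τ_perm K Φ k hk g g v₀ σ

/-- (Ported verbatim from the HodgeCMPerL package; no docstring in the source.) -/
lemma τ_ne_zero {g : Fin k → (PP K Φ).Idx} {v₀ : Fin (1+1+1+1) → (PP K Φ).Idx}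
    (h₀ : Function.Injective (Fin.append g v₀)) : τ K Φ k hk g g v₀ ≠ 0 := by
  unfold τ
  rw [ψ_mono, ψ_mono K Φ k hk ((PP K Φ).bar ∘ g), ← BC.comp_append]
  exact mul_ne_zero (vol_mono_ne_zero K Φ k hk _ h₀)
    (vol_mono_ne_zero K Φ k hk _ ((bar_injective (PP K Φ)).comp h₀))

/-- (Ported verbatim from the HodgeCMPerL package; no docstring in the source.) -/
lemma diag_ne_zero {g : Fin k → (PP K Φ).Idx} {v₀ : Fin (1+1+1+1) → (PP K Φ).Idx}
    (h₀ : Function.Injective (Fin.append g v₀)) :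
    ∑ a, ∑ b, ∑ c, ∑ d, τ K Φ k hk g g (q4 a b c d) ≠ 0 := by
  have hterm : ∀ a b c d, τ K Φ k hk g g (q4 a b c d)
      = τ K Φ k hk g g v₀ * (if Function.Injective (Fin.append g (q4 a b c d)) then 1 else 0) := by
    intro a b c d
    split_ifs with h
    · rw [mul_one]; exact τ_eq_of_injective K Φ k hk h₀ h
    · rw [mul_zero]; exact τ_eq_zero_left K Φ k hk h
  simp only [hterm, ← Finset.mul_sum]
  refine mul_ne_zero (τ_ne_zero K Φ k hk h₀) ?_
  have hc : (∑ a, ∑ b, ∑ c, ∑ d,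
      (if Function.Injective (Fin.append g (q4 a b c d)) then (1 : ℂ) else 0))
      = ((∑ a, ∑ b, ∑ c, ∑ d,
          (if Function.Injective (Fin.append g (q4 a b c d)) then 1 else 0) : ℕ) : ℂ) := by
    push_cast
    rfl
  rw [hc, Nat.cast_ne_zero]
  intro hN
  have h1 := Finset.sum_eq_zero_iff.mp hN (v₀ 0) (Finset.mem_univ _)
  have h2 := Finset.sum_eq_zero_iff.mp h1 (v₀ 1) (Finset.mem_univ _)
  have h3 := Finset.sum_eq_zero_iff.mp h2 (v₀ 2) (Finset.mem_univ _)
  have h4 := Finset.sum_eq_zero_iff.mp h3 (v₀ 3) (Finset.mem_univ _)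
  rw [q4_eta, if_pos h₀] at h4
  exact one_ne_zero h4

/-- (Ported verbatim from the HodgeCMPerL package; no docstring in the source.) -/
lemma exists_compl (S : Set.powersetCard (PP K Φ).Idx k) :
    ∃ v₀ : Fin (1+1+1+1) → (PP K Φ).Idx, Function.Injective (Fin.append (enum (PP K Φ) S) v₀) := by
  have hc : (Finset.univ \ S.val).card = 1+1+1+1 := by
    rw [Finset.card_univ_sdiff, S.prop, card_Idx_eq K Φ k hk]
    omega
  refine ⟨fun j => Finset.orderEmbOfFin _ hc j, Fin.append_injective_iff.mpr
    ⟨enum_injective _ S, (Finset.orderEmbOfFin _ hc).injective, fun i j h => ?_⟩⟩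
  have hj := Finset.orderEmbOfFin_mem (Finset.univ \ S.val) hc j
  rw [Finset.mem_sdiff] at hj
  exact hj.2 (h ▸ enum_mem _ S i)

/-- **Injectivity** of the eigen-sum operator `T4_{e,ē}`. -/
theorem T4L_injective :
    Function.Injective (T4L (vol K Φ k hk) (PP K Φ).eB (fun s => (PP K Φ).eB ((PP K Φ).bar s))) := by
  rw [injective_iff_map_eq_zero]
  intro z hz
  refine ((PP K Φ).eB.exteriorPower k).ext_elem_iff.mpr fun S => ?_
  rw [map_zero, Finsupp.zero_apply]
  obtain ⟨v₀, h₀⟩ := exists_compl K Φ k hk S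
  have key : ∀ S' : Set.powersetCard (PP K Φ).Idx k,
      ψ K Φ k hk ((PP K Φ).bar ∘ enum (PP K Φ) S)
          (T4L (vol K Φ k hk) (PP K Φ).eB (fun s => (PP K Φ).eB ((PP K Φ).bar s))
            ((PP K Φ).eB.exteriorPower k S'))
        = if S' = S then ∑ a, ∑ b, ∑ c, ∑ d,
            τ K Φ k hk (enum (PP K Φ) S) (enum (PP K Φ) S) (q4 a b c d) else 0 := by
    intro S'
    rw [basis_eq_mono, ψ_T4L_mono]
    split_ifs with hS
    · rw [hS]
    · refine Finset.sum_eq_zero fun a _ => Finset.sum_eq_zero fun b _ =>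
        Finset.sum_eq_zero fun c _ => Finset.sum_eq_zero fun d _ => ?_
      refine τ_eq_zero_of_ne K Φ k hk ?_ _
      rw [image_enum, image_enum]
      exact fun h => hS (Subtype.ext h)
  have h1 : ψ K Φ k hk ((PP K Φ).bar ∘ enum (PP K Φ) S)
      (T4L (vol K Φ k hk) (PP K Φ).eB (fun s => (PP K Φ).eB ((PP K Φ).bar s)) z)
      = ((PP K Φ).eB.exteriorPower k).repr z S
        * ∑ a, ∑ b, ∑ c, ∑ d, τ K Φ k hk (enum (PP K Φ) S) (enum (PP K Φ) S) (q4 a b c d) := by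
    conv_lhs => rw [← ((PP K Φ).eB.exteriorPower k).sum_repr z]
    rw [map_sum, map_sum, Finset.sum_eq_single S]
    · rw [LinearMap.map_smul, LinearMap.map_smul, smul_eq_mul, key, if_pos rfl]
    · intro S' _ hS'
      rw [LinearMap.map_smul, LinearMap.map_smul, smul_eq_mul, key, if_neg hS', mul_zero]
    · intro h
      exact absurd (Finset.mem_univ S) h
  rw [hz, map_zero] at h1
  exact (mul_eq_zero.mp h1.symm).resolve_right (diag_ne_zero K Φ k hk h₀)

/-- **Injectivity of `D`**. -/
theorem DQ_injective : Function.Injective (DQ K Φ k hk) := by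
  rw [injective_iff_map_eq_zero]
  intro y hy
  have h1 := theta_DQ_L K Φ k hk y
  rw [hy, TensorProduct.tmul_zero, map_zero, eq_comm, smul_eq_zero] at h1
  rcases h1 with h1 | h1
  · exact absurd h1 (inv_ne_zero (cst_ne_zero K Φ k hk))
  · have h2 : (PP K Φ).Θ k ((1 : ℂ) ⊗ₜ[ℚ] y) = 0 :=
      (injective_iff_map_eq_zero _).mp (T4L_injective K Φ k hk) _ h1
    rw [LinearEquiv.map_eq_zero_iff] at h2
    exact ofRat_injective (h2.trans (TensorProduct.tmul_zero _ (1 : ℂ)).symm)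

/-- **Bijectivity of `D`** (dimension count). -/
theorem DQ_bijective : Function.Bijective (DQ K Φ k hk) := by
  refine ⟨DQ_injective K Φ k hk, ?_⟩
  haveI : Module.Finite ℚ (⋀[ℚ]^k (PP K Φ).L) :=
    Module.Finite.of_basis ((Module.finBasis ℚ (PP K Φ).L).exteriorPower k)
  haveI : Module.Finite ℚ (⋀[ℚ]^(1+1+1+1) (PP K Φ).L) :=
    Module.Finite.of_basis ((Module.finBasis ℚ (PP K Φ).L).exteriorPower (1+1+1+1))
  refine (LinearMap.injective_iff_surjective_of_finrank_eq_finrank ?_).mp (DQ_injective K Φ k hk)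
  rw [exteriorPower.finrank_eq, exteriorPower.finrank_eq, hk]
  exact Nat.choose_symm_of_eq_add (by omega)

end Inj

/-! ## Part S10: assembly of M28 -/

section Assembly

/-- numerology: `rank_ℚ H¹(P) = 2 (dim P − 2) + 4` -/
lemma finrank_eq_k₀ (K : CMField) (Φ : Fin 4 → CMType K) :
    Module.finrank ℚ (PP K Φ).L
      = 2 * ((toyModelWith exteriorHodgeData).dim (PP K Φ) - 2) + 1+1+1+1 := by
  have h1 := four_add_k₀ (D := exteriorHodgeData) K Φ
  have h2 := card_idx_PP K Φ
  have h3 := finrank_L_PP K Φ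
  omega

/-- **M28 `Fact_algDuality` holds in the exterior model.** -/
theorem fact_algDuality : (toyModelWith exteriorHodgeData).Fact_algDuality := by
  intro K Φ
  have hk : Module.finrank ℚ (PP K Φ).L
      = 2 * ((toyModelWith exteriorHodgeData).dim ((toyModelWith exteriorHodgeData).prod4 K Φ) - 2)
        + 1+1+1+1 := finrank_eq_k₀ K Φ
  refine ⟨DQ K Φ _ hk, DQ_bijective K Φ _ hk, ?_, ?_⟩
  · rintro _ ⟨w, hw, rfl⟩
    change (PP K Φ).Θ (2 * ((toyModelWith exteriorHodgeData).dim
        ((toyModelWith exteriorHodgeData).prod4 K Φ) - 2)) ((1 : ℂ) ⊗ₜ[ℚ] w)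
      ∈ (PP K Φ).FF (2 * ((toyModelWith exteriorHodgeData).dim
        ((toyModelWith exteriorHodgeData).prod4 K Φ) - 2))
          (((toyModelWith exteriorHodgeData).dim ((toyModelWith exteriorHodgeData).prod4 K Φ) - 2 : ℕ) : ℤ)
      at hw
    change (PP K Φ).Θ (1+1+1+1) ((1 : ℂ) ⊗ₜ[ℚ] DQ K Φ _ hk w) ∈ (PP K Φ).FF (1+1+1+1) 2
    rw [theta_DQ_e]
    exact Submodule.smul_mem _ _ (T4_mem_FF K Φ _ hk _ rfl _ hw)
  · intro a Ma Mb hMa hMb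
    change map (1+1+1+1) Mb.lin ∘ₗ DQ K Φ _ hk ∘ₗ map _ Ma.lin = ((Algebra.norm ℚ a) ^ 4) • DQ K Φ _ hk
    rw [lin_eq_dμ hMa, lin_eq_dμ hMb]
    exact DQ_equivariant K Φ _ hk a

end Assembly

end HodgeCM.Toy

end
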